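import Literature.Barriers.CriticalPhenomena.FiniteRangeDecompositionSelfSimilarity
import HarnessLib

/-!
# Mass-insensitivity of the finite-range decomposition of `(-Δ_{ℤ^d}+s)⁻¹` below the mass scale:
# `w̄(y;σ)`, `G_L(y,σ)` are Lipschitz in `σ ≥ 0`, hence `|Γ_{j+1}(x;s) - Γ_{j+1}(x;0)| ≤ C(Λ^{1-d} + Λ^{2-d}·sΛ²)`

Companion of `FiniteRangeDecompositionSelfSimilarity.lean` (`Γ_{j+1}(x;s) = (Λ²/Λ^d)G_L(x/Λ,sΛ²) +
O(Λ/Λ^d)`, `Λ = L^{j+1}`, uniformly in `s ∈ [0,1]`) in the explicit [Baue13a]/BBS decomposition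
`Γ_j(s) = LongRangePhi4.FRD.Gam d L s j` used by Bauerschmidt–Brydges–Slade for the 4-dimensional
weakly self-avoiding walk. R. Bauerschmidt, D. C. Brydges, G. Slade, *A renormalisation group method.
III. Perturbative analysis*, J. Stat. Phys. **159** (2015), arXiv:1403.7252 [BBS-rg-pt], verify
Assumption (A1) of the flow paper for `m² > 0` (Proposition 4.2.2 there; quoted as "it is shown in
[BBS-rg-pt] that … Assumption (A1) [is] satisfied" in BBS, CMP 337 (2015), §6.1) through
Lemma 6.3.1: "`β_j(m²) ≥ c` for `n ≤ j ≤ j_m - n`", whose proof rests on the smallness of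
`|β_j(0) - β_j(m²)|` below the mass scale, obtained there from the mass-derivative bound of
Proposition 6.1.1(b) (`|∂C_{j;x,y}/∂m²| ≤ c(1+m²L^{2(j-1)})^{-k} log L`, `d = 4`, from [Baue13a]).

This file proves a mass-insensitivity estimate for `Γ_{j+1}(x;s)` sufficient for that use, by a
shorter road available in the tree: instead of differentiating the lattice kernel in `m²`, the
self-similarity of `FiniteRangeDecompositionSelfSimilarity.lean` reduces the `s`-dependence of
`Γ_{j+1}(·;s)` to that of the continuum inner kernel `G_L(y,σ)` (`FRD.cZeroKer`), i.e. of
`w̄(y;σ) = (2π)^{-d}∫f(√(|u|²+σ))cos(u·y)du` (`FRD.wbar`), which is LIPSCHITZ in `σ ≥ 0` uniformly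
in `y`: `∂_σ f(√(|u|²+σ)) = f'(ρ)/(2ρ)`, `ρ = √(|u|²+σ)`, is bounded (`f` even, so `f'(0) = 0` and
`|f'(ρ)| ≤ ‖f''‖_∞ρ`) and rapidly decaying in `u` (`|f'(ρ)| ≤ C_K(1+ρ)^{-K}`, `ρ ≥ |u|`).

## What this file proves (everything; no definition, no named fact)

* `deriv_profile_zero` (`f'(0) = 0`, evenness), `norm_deriv_profile_le_mul` (`‖f'(ρ)‖ ≤ M|ρ|`),
  `abs_profile_sqrt_sub_le` (the pointwise Lipschitz bound with the integrable weight
  `(1+‖u‖²)^{-d}`);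
* **`abs_wbar_mass_sub_le`** — `|w̄(y;σ₁) - w̄(y;σ₀)| ≤ C|σ₁ - σ₀|` for `σ₀, σ₁ ≥ 0`, all `y`;
* **`abs_cZeroKer_mass_sub_le`** — `|G_L(y,σ₁) - G_L(y,σ₀)| ≤ C_L|σ₁ - σ₀|`;
* **`abs_Gam_mass_sub_le`** — for `d ≥ 1`, `L ≥ 2`: `|Γ_{j+1}(x;s) - Γ_{j+1}(x;0)| ≤
  C_L(Λ/Λ^d + (Λ²/Λ^d)·sΛ²)`, `Λ = L^{j+1}`, for all `s ∈ [0,1]`, `j ≥ 1`, `x` (for `d = 4`: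
  `≤ C_L(L^{-3(j+1)} + s)`), the input of Lemma 6.3.1 of [BBS-rg-pt] for the explicit decomposition.
-/

noncomputable section

namespace Literature.Barriers.CriticalPhenomena

open _root_.MeasureTheory Set Filter
open scoped _root_.Topology Real

namespace LongRangePhi4

namespace FRD

open Literature.Probability.LatticeModels

variable {d : ℕ}

/-! ### The profile: `f'(0) = 0` and `‖f'(ρ)‖ ≤ M|ρ|` -/

/-- `f` is even, so `f'(0) = 0`. [folklore] -/
theorem deriv_profile_zero : deriv (⇑profile) 0 = 0 := by
  have h1 : deriv (fun v : ℝ => profile (-v)) 0 = -deriv (⇑profile) (-0) := deriv_comp_neg (⇑profile) 0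
  have h2 : (fun v : ℝ => profile (-v)) = ⇑profile := funext fun v => profile_neg v
  rw [h2, neg_zero] at h1
  have : (2 : ℂ) * deriv (⇑profile) 0 = 0 := by linear_combination h1
  simpa using this

/-- **`‖f'(ρ)‖ ≤ M|ρ|`** (`f'(0) = 0` and `f''` bounded, `f` Schwartz). [folklore] -/
theorem norm_deriv_profile_le_mul : ∃ M : ℝ, 0 < M ∧ ∀ ρ : ℝ, ‖deriv (⇑profile) ρ‖ ≤ M * |ρ| := by
  have hGe : ⇑(SchwartzMap.derivCLM ℝ ℂ profile) = deriv (⇑profile) :=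
    funext fun v => SchwartzMap.derivCLM_apply (𝕜 := ℝ) profile v
  obtain ⟨M, hM, hb⟩ := norm_deriv_le_div_one_add_pow (SchwartzMap.derivCLM ℝ ℂ profile) 0
  refine ⟨M, hM, fun ρ => ?_⟩
  have hmvt := Convex.norm_image_sub_le_of_norm_deriv_le
    (f := ⇑(SchwartzMap.derivCLM ℝ ℂ profile)) (s := univ) (C := M)
    (fun u _ => (SchwartzMap.derivCLM ℝ ℂ profile).differentiableAt)
    (fun u _ => by simpa using hb u) convex_univ (mem_univ 0) (mem_univ ρ)
  rw [hGe, deriv_profile_zero, sub_zero, sub_zero, Real.norm_eq_abs] at hmvt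
  exact hmvt

/-! ### The pointwise Lipschitz bound for `σ ↦ f(√(|u|²+σ))` -/

/-- **`|Re f(√(|u|²+σ₁)) - Re f(√(|u|²+σ₀))| ≤ D(1+‖u‖²)^{-d}|σ₁-σ₀|`** for `σ₀, σ₁ > 0` and all
`u ∈ ℝ^d`: the `σ`-derivative `Re f'(ρ)/(2ρ)`, `ρ = √(|u|²+σ) ≥ ‖u‖`, is at most `M/2`
(`‖f'(ρ)‖ ≤ Mρ`) and at most `C(1+ρ)^{-2d}/(2ρ)` (Schwartz decay). [folklore] -/
theorem abs_profile_sqrt_sub_le :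
    ∃ D : ℝ, 0 < D ∧ ∀ u : Fin d → ℝ, ∀ σ₀ σ₁ : ℝ, 0 < σ₀ → 0 < σ₁ →
      |(profile (Real.sqrt (sqNorm u + σ₁))).re - (profile (Real.sqrt (sqNorm u + σ₀))).re| ≤
        D * ((1 + ‖u‖ ^ 2) ^ d)⁻¹ * |σ₁ - σ₀| := by
  obtain ⟨M, hM, hMb⟩ := norm_deriv_profile_le_mul
  have hGe : ∀ v, SchwartzMap.derivCLM ℝ ℂ profile v = deriv (⇑profile) v := fun v =>
    SchwartzMap.derivCLM_apply (𝕜 := ℝ) profile v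
  obtain ⟨C, hC, hCb⟩ := norm_le_div_one_add_pow (SchwartzMap.derivCLM ℝ ℂ profile) (2 * d)
  -- the constant
  refine ⟨M * 2 ^ (2 * d) + C, by positivity, fun u σ₀ σ₁ hσ₀ hσ₁ => ?_⟩
  set X : ℝ := sqNorm u with hX
  have hX0 : 0 ≤ X := sqNorm_nonneg u
  set φ : ℝ → ℝ := fun σ => (profile (Real.sqrt (X + σ))).re with hφ
  set w : ℝ := ((1 + ‖u‖ ^ 2) ^ d)⁻¹ with hw
  have hw0 : 0 < w := by positivity
  -- derivative of `φ` on `(0,∞)` and its bound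
  have hderiv : ∀ σ : ℝ, 0 < σ →
      HasDerivAt φ ((1 / (2 * Real.sqrt (X + σ))) * (deriv (⇑profile) (Real.sqrt (X + σ))).re) σ := by
    intro σ hσ
    have hpos : 0 < X + σ := by linarith
    have h1 : HasDerivAt (fun σ : ℝ => X + σ) 1 σ := (hasDerivAt_id σ).const_add X
    have h2 : HasDerivAt (fun σ : ℝ => Real.sqrt (X + σ)) (1 / (2 * Real.sqrt (X + σ)) * 1) σ :=
      (Real.hasDerivAt_sqrt hpos.ne').comp σ h1
    rw [mul_one] at h2
    have h3 : HasDerivAt (⇑profile) (deriv (⇑profile) (Real.sqrt (X + σ))) (Real.sqrt (X + σ)) :=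
      profile.differentiableAt.hasDerivAt
    have h4 := h3.scomp σ h2
    have h5 := (Complex.reCLM.hasFDerivAt).comp_hasDerivAt σ h4
    refine h5.congr_deriv ?_
    simp
  have hbound : ∀ σ : ℝ, 0 < σ → |deriv φ σ| ≤ (M * 2 ^ (2 * d) + C) * w := by
    intro σ hσ
    rw [(hderiv σ hσ).deriv]
    have hpos : 0 < X + σ := by linarith
    set ρ : ℝ := Real.sqrt (X + σ) with hρ
    have hρ0 : 0 < ρ := Real.sqrt_pos.2 hpos
    have hρu : ‖u‖ ≤ ρ := by
      rw [hρ, ← Real.sqrt_sq (norm_nonneg u)]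
      exact Real.sqrt_le_sqrt (by linarith [norm_sq_le_sqNorm u])
    have hre : |(deriv (⇑profile) ρ).re| ≤ ‖deriv (⇑profile) ρ‖ := Complex.abs_re_le_norm _
    rw [abs_mul, abs_of_pos (by positivity : (0 : ℝ) < 1 / (2 * ρ))]
    -- two bounds for `‖f'(ρ)‖/(2ρ)`
    have hA : 1 / (2 * ρ) * ‖deriv (⇑profile) ρ‖ ≤ M / 2 := by
      have := hMb ρ
      rw [abs_of_pos hρ0] at this
      calc 1 / (2 * ρ) * ‖deriv (⇑profile) ρ‖ ≤ 1 / (2 * ρ) * (M * ρ) :=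
            mul_le_mul_of_nonneg_left this (by positivity)
        _ = M / 2 := by field_simp
    have hB : 1 / (2 * ρ) * ‖deriv (⇑profile) ρ‖ ≤ C / ((1 + ρ) ^ (2 * d)) / (2 * ρ) := by
      have := hCb ρ
      rw [hGe, abs_of_pos hρ0] at this
      rw [one_div, inv_mul_eq_div]
      exact div_le_div_of_nonneg_right this (by positivity)
    -- `w ≥ (1+ρ)^{-2d}`-type comparisons
    have hwρ : ((1 + ρ) ^ (2 * d))⁻¹ ≤ w := by
      rw [hw]
      refine inv_anti₀ (by positivity) ?_
      rw [pow_mul]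
      refine pow_le_pow_left₀ (by positivity) ?_ d
      nlinarith [norm_nonneg u, hρ0.le]
    rcases le_or_gt 1 ρ with hρ1 | hρ1
    · -- `ρ ≥ 1`: use the decay bound
      calc 1 / (2 * ρ) * |(deriv (⇑profile) ρ).re| ≤ 1 / (2 * ρ) * ‖deriv (⇑profile) ρ‖ :=
            mul_le_mul_of_nonneg_left hre (by positivity)
        _ ≤ C / ((1 + ρ) ^ (2 * d)) / (2 * ρ) := hB
        _ ≤ C / ((1 + ρ) ^ (2 * d)) := by
            refine div_le_self (by positivity) (by linarith)
        _ = C * ((1 + ρ) ^ (2 * d))⁻¹ := by rw [div_eq_mul_inv]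
        _ ≤ C * w := mul_le_mul_of_nonneg_left hwρ hC.le
        _ ≤ (M * 2 ^ (2 * d) + C) * w := by
            have h' : 0 ≤ M * 2 ^ (2 * d) * w := by positivity
            nlinarith [h']
    · -- `ρ < 1`: use `‖f'(ρ)‖ ≤ Mρ` and `w ≥ 2^{-2d}`
      have hw2 : ((2 : ℝ) ^ (2 * d))⁻¹ ≤ w := by
        refine le_trans (inv_anti₀ (by positivity) ?_) hwρ
        exact pow_le_pow_left₀ (by positivity) (by linarith) _
      calc 1 / (2 * ρ) * |(deriv (⇑profile) ρ).re| ≤ 1 / (2 * ρ) * ‖deriv (⇑profile) ρ‖ :=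
            mul_le_mul_of_nonneg_left hre (by positivity)
        _ ≤ M / 2 := hA
        _ ≤ M := by linarith
        _ = M * 2 ^ (2 * d) * ((2 : ℝ) ^ (2 * d))⁻¹ := by
            rw [mul_assoc, mul_inv_cancel₀ (by positivity), mul_one]
        _ ≤ M * 2 ^ (2 * d) * w := mul_le_mul_of_nonneg_left hw2 (by positivity)
        _ ≤ (M * 2 ^ (2 * d) + C) * w := by
            have h' : 0 ≤ C * w := by positivity
            nlinarith [h']
  -- mean value theorem on `(0,∞)`
  have hmvt := Convex.norm_image_sub_le_of_norm_deriv_le (f := φ) (s := Ioi (0 : ℝ))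
    (C := (M * 2 ^ (2 * d) + C) * w)
    (fun σ hσ => (hderiv σ hσ).differentiableAt)
    (fun σ hσ => by rw [Real.norm_eq_abs]; exact hbound σ hσ) (convex_Ioi 0) hσ₀ hσ₁
  rw [Real.norm_eq_abs, Real.norm_eq_abs] at hmvt
  calc |(profile (Real.sqrt (sqNorm u + σ₁))).re - (profile (Real.sqrt (sqNorm u + σ₀))).re|
      = |φ σ₁ - φ σ₀| := rfl
    _ ≤ (M * 2 ^ (2 * d) + C) * w * |σ₁ - σ₀| := hmvt
    _ = (M * 2 ^ (2 * d) + C) * ((1 + ‖u‖ ^ 2) ^ d)⁻¹ * |σ₁ - σ₀| := rfl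

/-! ### `w̄(y;σ)` is Lipschitz in `σ ≥ 0` -/

/-- The integrand of `w̄(y;σ)` is integrable over `ℝ^d` (`σ ≥ 0`, `d ≥ 1`). [folklore] -/
theorem integrable_wbar_integrand (hd : 1 ≤ d) {σ : ℝ} (hσ : 0 ≤ σ) (y : Fin d → ℝ) :
    Integrable fun u : Fin d → ℝ =>
      (profile (Real.sqrt (sqNorm u + σ))).re * Real.cos (∑ i, u i * y i) := by
  have hsq : Continuous (sqNorm : (Fin d → ℝ) → ℝ) := by
    unfold sqNorm; fun_prop
  set g : (Fin d → ℝ) → ℝ := fun u => ((1 + ‖u‖ ^ 2) ^ d)⁻¹ with hg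
  have hgi : Integrable g := integrable_inv_one_add_norm_sq_pow (by omega)
  obtain ⟨C, hC, hf⟩ := abs_profile_sqrt_le profile d
  have hcont : Continuous fun u : Fin d → ℝ =>
      (profile (Real.sqrt (sqNorm u + σ))).re * Real.cos (∑ i, u i * y i) :=
    (Complex.continuous_re.comp (profile.continuous.comp (hsq.add continuous_const).sqrt)).mul
      (Real.continuous_cos.comp (by fun_prop))
  refine Integrable.mono' (hgi.const_mul C) hcont.aestronglyMeasurable (Eventually.of_forall fun u => ?_)
  rw [Real.norm_eq_abs, abs_mul]
  refine (mul_le_of_le_one_right (abs_nonneg _) (Real.abs_cos_le_one _)).trans ?_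
  have h1 := hf 1 zero_le_one (sqNorm u + σ) (add_nonneg (sqNorm_nonneg u) hσ)
  rw [one_mul, one_pow, one_mul] at h1
  refine h1.trans ?_
  rw [hg]
  refine mul_le_mul_of_nonneg_left (inv_anti₀ (by positivity) (pow_le_pow_left₀ (by positivity) ?_ d)) hC.le
  linarith [norm_sq_le_sqNorm u]

/-- **`w̄(y;σ)` is Lipschitz in `σ ≥ 0`, uniformly in `y`**: `|w̄(y;σ₁) - w̄(y;σ₀)| ≤ C|σ₁ - σ₀|`
(`d ≥ 1`). For `σ₀, σ₁ > 0` from the pointwise bound; the end-point `0` by the continuity of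
`σ ↦ w̄(y;σ)` on `[0,∞)`. [folklore] -/
theorem abs_wbar_mass_sub_le (hd : 1 ≤ d) :
    ∃ C : ℝ, 0 < C ∧ ∀ σ₀ σ₁ : ℝ, 0 ≤ σ₀ → 0 ≤ σ₁ → ∀ y : Fin d → ℝ,
      |wbar d σ₁ y - wbar d σ₀ y| ≤ C * |σ₁ - σ₀| := by
  obtain ⟨D, hD, hpt⟩ := abs_profile_sqrt_sub_le (d := d)
  set g : (Fin d → ℝ) → ℝ := fun u => ((1 + ‖u‖ ^ 2) ^ d)⁻¹ with hg
  have hgi : Integrable g := integrable_inv_one_add_norm_sq_pow (by omega)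
  have hg0 : ∀ u, 0 ≤ g u := fun u => by positivity
  set I : ℝ := ∫ u, g u with hI
  have hI0 : 0 ≤ I := integral_nonneg hg0
  have hπd : (0 : ℝ) < ((2 * π) ^ d : ℝ)⁻¹ := by positivity
  set C : ℝ := ((2 * π) ^ d : ℝ)⁻¹ * (D * I) + 1 with hCdef
  have hC : 0 < C := by positivity
  -- the positive case
  have hposcase : ∀ σ₀ σ₁ : ℝ, 0 < σ₀ → 0 < σ₁ → ∀ y : Fin d → ℝ,
      |wbar d σ₁ y - wbar d σ₀ y| ≤ C * |σ₁ - σ₀| := by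
    intro σ₀ σ₁ hσ₀ hσ₁ y
    have h1 := integrable_wbar_integrand hd hσ₁.le y
    have h0 := integrable_wbar_integrand hd hσ₀.le y
    unfold wbar
    rw [← mul_sub, ← integral_sub h1 h0, abs_mul, abs_of_pos hπd]
    have hb := norm_integral_le_of_norm_le (hgi.const_mul (D * |σ₁ - σ₀|))
      (Eventually.of_forall fun u => (by
        rw [Real.norm_eq_abs, ← sub_mul, abs_mul]
        refine (mul_le_of_le_one_right (abs_nonneg _) (Real.abs_cos_le_one _)).trans ?_
        have := hpt u σ₀ σ₁ hσ₀ hσ₁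
        simp only [hg]
        linarith [this] :
        ‖(profile (Real.sqrt (sqNorm u + σ₁))).re * Real.cos (∑ i, u i * y i) -
            (profile (Real.sqrt (sqNorm u + σ₀))).re * Real.cos (∑ i, u i * y i)‖ ≤
          D * |σ₁ - σ₀| * g u))
    rw [Real.norm_eq_abs, integral_const_mul] at hb
    calc ((2 * π) ^ d : ℝ)⁻¹ * |∫ u : Fin d → ℝ,
          ((profile (Real.sqrt (sqNorm u + σ₁))).re * Real.cos (∑ i, u i * y i) -
            (profile (Real.sqrt (sqNorm u + σ₀))).re * Real.cos (∑ i, u i * y i))|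
        ≤ ((2 * π) ^ d : ℝ)⁻¹ * (D * |σ₁ - σ₀| * I) := mul_le_mul_of_nonneg_left hb hπd.le
      _ = ((2 * π) ^ d : ℝ)⁻¹ * (D * I) * |σ₁ - σ₀| := by ring
      _ ≤ C * |σ₁ - σ₀| := by
          have : 0 ≤ |σ₁ - σ₀| := abs_nonneg _
          rw [hCdef]; nlinarith
  refine ⟨C, hC, fun σ₀ σ₁ hσ₀ hσ₁ y => ?_⟩
  -- pass to the limit in the smaller of `σ₀, σ₁` when it is `0`
  have key : ∀ a b : ℝ, 0 ≤ a → 0 < b → |wbar d b y - wbar d a y| ≤ C * |b - a| := by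
    intro a b ha hb
    rcases ha.lt_or_eq with ha' | ha'
    · exact hposcase a b ha' hb y
    · subst ha'
      have hcont := continuousWithinAt_wbar_sigma hd y 0
      have hT : Tendsto (fun a : ℝ => |wbar d b y - wbar d a y|) (𝓝[>] 0)
          (𝓝 |wbar d b y - wbar d 0 y|) :=
        ((continuous_abs.tendsto _).comp (tendsto_const_nhds.sub
          (hcont.tendsto.mono_left (nhdsWithin_mono _ Ioi_subset_Ici_self))))
      have hT' : Tendsto (fun a : ℝ => C * |b - a|) (𝓝[>] 0) (𝓝 (C * |b - 0|)) :=
        ((continuous_const.mul (continuous_abs.comp (continuous_const.sub continuous_id))).tendsto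
          (0 : ℝ)).mono_left nhdsWithin_le_nhds
      refine le_of_tendsto_of_tendsto hT hT' ?_
      filter_upwards [self_mem_nhdsWithin] with a ha using hposcase a b ha hb y
  rcases hσ₁.lt_or_eq with h1 | h1
  · exact key σ₀ σ₁ hσ₀ h1
  · rcases hσ₀.lt_or_eq with h0 | h0
    · rw [abs_sub_comm, abs_sub_comm σ₁]
      exact key σ₁ σ₀ hσ₁ h0
    · subst h1; subst h0; simp

/-! ### `G_L(y,σ)` is Lipschitz in `σ ≥ 0` -/

/-- **`|G_L(y,σ₁) - G_L(y,σ₀)| ≤ C_L|σ₁ - σ₀|`** for `σ₀, σ₁ ≥ 0`, all `y` (`d ≥ 1`, `L ≥ 1`): the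
`τ`-integrand over `(1/(2L), ½]` inherits the Lipschitz bound of `w̄` with the factor `τ²/(2d) ≤ 1`.
[folklore] -/
theorem abs_cZeroKer_mass_sub_le (hd : 1 ≤ d) {L : ℝ} (hL : 1 ≤ L) :
    ∃ C : ℝ, 0 < C ∧ ∀ σ₀ σ₁ : ℝ, 0 ≤ σ₀ → 0 ≤ σ₁ → ∀ y : Fin d → ℝ,
      |cZeroKer d L y σ₁ - cZeroKer d L y σ₀| ≤ C * |σ₁ - σ₀| := by
  have hd' : (1 : ℝ) ≤ d := by exact_mod_cast hd
  have hc := cProfile_pos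
  obtain ⟨Cw, hCw, hw⟩ := abs_wbar_mass_sub_le hd
  obtain ⟨P, hP, hb⟩ := abs_cZeroIntegrand_le hd hL
  have hM0 : 0 < Real.sqrt (2 * d) := Real.sqrt_pos.2 (by positivity)
  have hL0 : 0 < L := by linarith
  set K : ℝ := (Real.sqrt (2 * d) * (2 * L)) ^ d * (1 / (cProfile * (2 * d))) * Cw * (2 * L) with hK
  have hK0 : 0 < K := by positivity
  refine ⟨K, hK0, fun σ₀ σ₁ hσ₀ hσ₁ y => ?_⟩
  -- pointwise bound on the difference of the integrands
  have hpt : ∀ τ ∈ Ioc (1 / (2 * L)) (1 / 2),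
      |cZeroIntegrand d y σ₁ τ - cZeroIntegrand d y σ₀ τ| ≤ K * |σ₁ - σ₀| := by
    intro τ hτ
    have hτ0 : 0 < τ := lt_trans (by positivity) hτ.1
    have hτL : 1 / (2 * L) < τ := hτ.1
    have hτ2 : τ ≤ 1 / 2 := hτ.2
    unfold cZeroIntegrand
    rw [← sub_div, ← mul_sub, abs_div, abs_of_pos hτ0, abs_mul, abs_mul]
    have h1 : |(Real.sqrt (2 * d) / τ) ^ d| ≤ (Real.sqrt (2 * d) * (2 * L)) ^ d := by
      rw [abs_of_nonneg (by positivity)]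
      refine pow_le_pow_left₀ (by positivity) ?_ d
      rw [div_le_iff₀ hτ0]
      have : 1 ≤ 2 * L * τ := by
        rw [div_lt_iff₀ (by positivity)] at hτL; linarith
      nlinarith [hM0.le]
    have h2 : |τ ^ 2 / (cProfile * (2 * d))| ≤ 1 / (cProfile * (2 * d)) := by
      rw [abs_of_nonneg (by positivity)]
      refine div_le_div_of_nonneg_right ?_ (by positivity)
      nlinarith
    have h3 : |wbar d (σ₁ * τ ^ 2 / (2 * d)) (fun i => Real.sqrt (2 * d) * y i / τ) -
        wbar d (σ₀ * τ ^ 2 / (2 * d)) (fun i => Real.sqrt (2 * d) * y i / τ)| ≤ Cw * |σ₁ - σ₀| := by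
      have := hw (σ₀ * τ ^ 2 / (2 * d)) (σ₁ * τ ^ 2 / (2 * d)) (by positivity) (by positivity)
        (fun i => Real.sqrt (2 * d) * y i / τ)
      refine this.trans ?_
      rw [← sub_div, ← sub_mul, abs_div, abs_mul, abs_of_pos (by positivity : (0 : ℝ) < 2 * d),
        abs_of_pos (by positivity : (0 : ℝ) < τ ^ 2)]
      refine mul_le_mul_of_nonneg_left ?_ hCw.le
      rw [div_le_iff₀ (by positivity)]
      have hτsq : τ ^ 2 ≤ 1 := by nlinarith
      have : 0 ≤ |σ₁ - σ₀| := abs_nonneg _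
      nlinarith
    have h4 : (1 : ℝ) / τ ≤ 2 * L := by
      rw [div_le_iff₀ hτ0]
      rw [div_lt_iff₀ (by positivity)] at hτL; linarith
    calc |(Real.sqrt (2 * d) / τ) ^ d| * |τ ^ 2 / (cProfile * (2 * d))| *
          |wbar d (σ₁ * τ ^ 2 / (2 * d)) (fun i => Real.sqrt (2 * d) * y i / τ) -
            wbar d (σ₀ * τ ^ 2 / (2 * d)) (fun i => Real.sqrt (2 * d) * y i / τ)| / τ
        = |(Real.sqrt (2 * d) / τ) ^ d| * |τ ^ 2 / (cProfile * (2 * d))| *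
          |wbar d (σ₁ * τ ^ 2 / (2 * d)) (fun i => Real.sqrt (2 * d) * y i / τ) -
            wbar d (σ₀ * τ ^ 2 / (2 * d)) (fun i => Real.sqrt (2 * d) * y i / τ)| * (1 / τ) := by
          ring
      _ ≤ (Real.sqrt (2 * d) * (2 * L)) ^ d * (1 / (cProfile * (2 * d))) * (Cw * |σ₁ - σ₀|) *
          (2 * L) := by gcongr
      _ = K * |σ₁ - σ₀| := by rw [hK]; ring
  -- integrate over the `τ`-interval (length `≤ ½ ≤ 1`)
  have hμ : (volume : Measure ℝ) (Ioc (1 / (2 * L)) (1 / 2)) ≠ ⊤ := by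
    rw [Real.volume_Ioc]; exact ENNReal.ofReal_ne_top
  have hint : ∀ σ : ℝ, 0 ≤ σ → IntegrableOn (cZeroIntegrand d y σ) (Ioc (1 / (2 * L)) (1 / 2)) := by
    intro σ hσ
    refine Measure.integrableOn_of_bounded (M := P) hμ
      (measurable_cZeroIntegrand_right y σ).aestronglyMeasurable ?_
    refine (ae_restrict_iff' measurableSet_Ioc).2 (ae_of_all _ fun τ hτ => ?_)
    rw [Real.norm_eq_abs]
    exact hb σ hσ y τ hτ
  unfold cZeroKer
  rw [← integral_sub (hint σ₁ hσ₁) (hint σ₀ hσ₀)]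
  have hB := norm_setIntegral_le_of_norm_le_const (lt_top_iff_ne_top.2 hμ)
    (fun τ hτ => (by rw [Real.norm_eq_abs]; exact hpt τ hτ :
      ‖cZeroIntegrand d y σ₁ τ - cZeroIntegrand d y σ₀ τ‖ ≤ K * |σ₁ - σ₀|))
  rw [Real.norm_eq_abs, Real.volume_real_Ioc] at hB
  refine hB.trans ?_
  have hlen : max (1 / 2 - 1 / (2 * L)) 0 ≤ 1 := by
    refine max_le ?_ zero_le_one
    have : 0 < 1 / (2 * L) := by positivity
    linarith
  have : 0 ≤ K * |σ₁ - σ₀| := by positivity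
  nlinarith

/-! ### Mass-insensitivity of `Γ_{j+1}(x;s)` -/

/-- **Mass-insensitivity of the decomposition below the mass scale**: for `d ≥ 1`, `L ≥ 2` there is
`C = C(d,L)` such that for all `s ∈ [0,1]`, `j ≥ 1`, `x ∈ ℤ^d`, with `Λ = L^{j+1}`,
`|Γ_{j+1}(x;s) - Γ_{j+1}(x;0)| ≤ C(Λ/Λ^d + (Λ²/Λ^d)(sΛ²))` — by self-similarity at `s` and at `0`
(two errors `O(Λ/Λ^d)`) and the Lipschitz bound `|G_L(x/Λ, sΛ²) - G_L(x/Λ, 0)| ≤ C_LsΛ²`. For `d = 4`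
this is `O(L^{-3j} + s)`, small below the mass scale `sL^{2j} ≤ 1` — the role played in [BBS-rg-pt]
by Proposition 6.1.1(b) (`|∂C_j/∂m²| ≤ c log L`, `d = 4`) in the proof of Lemma 6.3.1.
[cite: BauerschmidtBrydgesSlade2015LogCorr, §6.1 ("it is shown in [BBS-rg-pt] that … Assumption (A1) [is] satisfied")] -/
theorem abs_Gam_mass_sub_le (hd : 1 ≤ d) {L : ℝ} (hL : 2 ≤ L) :
    ∃ C : ℝ, 0 < C ∧ ∀ s : ℝ, 0 ≤ s → s ≤ 1 → ∀ j : ℕ, 1 ≤ j → ∀ x : Site d,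
      |Gam d L s (j + 1) x - Gam d L 0 (j + 1) x| ≤
        C * (L ^ (j + 1) / (L ^ (j + 1)) ^ d +
          (L ^ (j + 1)) ^ 2 / (L ^ (j + 1)) ^ d * (s * (L ^ (j + 1)) ^ 2)) := by
  have hL1 : (1 : ℝ) ≤ L := by linarith
  have hL0 : (0 : ℝ) < L := by linarith
  obtain ⟨C₁, hC₁, hS⟩ := abs_Gam_sub_scaling_le hd hL
  obtain ⟨C₂, hC₂, hG⟩ := abs_cZeroKer_mass_sub_le hd hL1
  refine ⟨2 * C₁ + C₂, by positivity, fun s hs hs1 j hj x => ?_⟩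
  set Λ : ℝ := L ^ (j + 1) with hΛ
  have hΛ0 : 0 < Λ := pow_pos hL0 _
  set y : Fin d → ℝ := fun i => (x i : ℝ) / Λ
  have h1 := hS s hs hs1 j hj x
  have h0 := hS 0 le_rfl zero_le_one j hj x
  have h2 := hG 0 (s * Λ ^ 2) le_rfl (by positivity) y
  rw [sub_zero, abs_of_nonneg (by positivity : (0 : ℝ) ≤ s * Λ ^ 2)] at h2
  simp only [zero_mul] at h0
  have hA : 0 ≤ Λ / Λ ^ d := by positivity
  have hB : 0 ≤ Λ ^ 2 / Λ ^ d := by positivity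
  -- triangle inequality
  have key : |Gam d L s (j + 1) x - Gam d L 0 (j + 1) x| ≤
      C₁ * (Λ / Λ ^ d) + C₁ * (Λ / Λ ^ d) + Λ ^ 2 / Λ ^ d * (C₂ * (s * Λ ^ 2)) := by
    have e : Gam d L s (j + 1) x - Gam d L 0 (j + 1) x =
        (Gam d L s (j + 1) x - Λ ^ 2 / Λ ^ d * cZeroKer d L y (s * Λ ^ 2)) -
        (Gam d L 0 (j + 1) x - Λ ^ 2 / Λ ^ d * cZeroKer d L y 0) +
        Λ ^ 2 / Λ ^ d * (cZeroKer d L y (s * Λ ^ 2) - cZeroKer d L y 0) := by ring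
    rw [e]
    refine (abs_add_le _ _).trans (add_le_add ((abs_sub _ _).trans (add_le_add h1 h0)) ?_)
    rw [abs_mul, abs_of_nonneg hB]
    exact mul_le_mul_of_nonneg_left h2 hB
  have hextra : 0 ≤ 2 * C₁ * (Λ ^ 2 / Λ ^ d * (s * Λ ^ 2)) + C₂ * (Λ / Λ ^ d) := by positivity
  calc |Gam d L s (j + 1) x - Gam d L 0 (j + 1) x|
      ≤ C₁ * (Λ / Λ ^ d) + C₁ * (Λ / Λ ^ d) + Λ ^ 2 / Λ ^ d * (C₂ * (s * Λ ^ 2)) := key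
    _ ≤ C₁ * (Λ / Λ ^ d) + C₁ * (Λ / Λ ^ d) + Λ ^ 2 / Λ ^ d * (C₂ * (s * Λ ^ 2)) +
        (2 * C₁ * (Λ ^ 2 / Λ ^ d * (s * Λ ^ 2)) + C₂ * (Λ / Λ ^ d)) := le_add_of_nonneg_right hextra
    _ = (2 * C₁ + C₂) * (Λ / Λ ^ d + Λ ^ 2 / Λ ^ d * (s * Λ ^ 2)) := by ring

end FRD

end LongRangePhi4

end Literature.Barriers.CriticalPhenomena
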